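import Summits.ResolutionOfSingularities.ResolutionOfSingularities.Theorems.WeightedInvariantELadderTwoOrbitClosurePoint
import Summits.ResolutionOfSingularities.ResolutionOfSingularities.Theorems.WeightedInvariantELadderTwoGenericOffSupport
import Summits.ResolutionOfSingularities.ResolutionOfSingularities.Theorems.WeightedInvariantELadderTwoReadChart
import Summits.ResolutionOfSingularities.ResolutionOfSingularities.Theorems.WeightedInvariantE2HomogeneousShrink
import Summits.ResolutionOfSingularities.ResolutionOfSingularities.Theorems.WeightedInvariantHypersurfaceCentreAssemblyPointDict
import Mathlib.RingTheory.Ideal.KrullsHeightTheorem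
import HarnessLib

/-!
# E-ladder rung `e = 2`, centre piece (C-c), scheme hand (o47-c-scheme): ZEROS OF A MODEL CHART and THE COVER OF THE SUPPORT

[OURS · L1 W4.3 · DOOR `HypersurfaceCentreConstruction` (stmt-ResolutionOfSingularities-19897) · E2 CENTRE piece (C-c), steps (M1)/(G-1) of the
registrar's DESIGN MEMO `E2-CENTRE-GLUE-DESIGN-v0.md` / SPEC (Δ11b) rev 10; written by res-D-pv-048 (gen 11).  Def-free; `--supports` the door
item as a helper.  OURS bookkeeping, NOT a statement of [Hironaka2017]; AI work, weaker than expert review.]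

Fix a stage `S` with (I0)₂, a UNIT chart `W a`, a homogeneous section `t` and homogeneous parameters `U : Fin N → Γ(Y, W a)`, `N ≤ 3`, with the
ZERO READING (S6) of `Stage.exists_e2ModelChartAt` (…ELadderTwoCentreChartAt): at every `y ∈ D(t)` with `dim 𝒪_{Y,y} ≤ 3`, all `U i` vanish at
`y` iff `y ∈ singImage` and `ι_y = mu₂`.  Write `M := closure (maxLocus₂ ι)`.

* `Stage.mem_closure_maxLocus₂_of_forall_germ_mem` — **(M1) `V(U) ∩ D(t) ⊆ M`.**  A common zero `y` of the `U i` generises to the point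
  `z` of a minimal prime `𝔷 ⊆ 𝔭(y)` over `(U)`: `𝔷` is HOMOGENEOUS, of height `≤ N ≤ 3` (Krull), so (S6) puts `z` in `singImage` with
  `ι_z = mu₂`; every CLOSED point `c` of `closure {z} ∩ D(t)` (Jacobson: they are dense) is then in `singImage`, its orbit-generic point
  `η(c)` (`𝔭(η(c)) = core 𝔭(c) ⊇ 𝔷`, …ELadderTwoOrbitClosurePoint) lies in `singImage` (torus lemma
  `mem_singImage_of_isOrbitGeneric_of_specializes`), has `dim ≤ 3` (U6) and kills the `U i`, so (S6) gives `ι = mu₂`: `η(c) ∈ maxLocus₂`,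
  whence `c ∈ M`, `z ∈ M`, `y ∈ M`.
* `Stage.forall_germ_mem_of_mem_closure_maxLocus₂` — **`M ∩ D(t) ⊆ V(U)`** (the `U i` vanish on `maxLocus₂ ∩ D(t)` by (S6), a dense subset).
* `Stage.exists_mem_maxLocus₂_primeIdealOf_eq_homogeneousCore` — **THE COVER (G-1)**: under (C-b) «read points of `M` are in `maxLocus₂`», for a
  CLOSED point `c ∈ M` on a unit chart, the orbit-generic point `η(c)` is in `maxLocus₂` (it is in `genSing₂`, and in `M` because `M ∩ W a` is cut
  out by primes of orbit-generic points, all homogeneous); and `c ∈ D(t)` for every HOMOGENEOUS `t ∉ 𝔭(η(c))`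
  (`Stage.mem_basicOpen_of_primeIdealOf_eq_homogeneousCore`).
-/

noncomputable section

set_option linter.dupNamespace false
set_option backward.isDefEq.respectTransparency false

open CategoryTheory AlgebraicGeometry TopologicalSpace IsLocalRing
open Literature.AlgebraicGeometry.Resolution
open Summit.ResolutionOfSingularities.ResolutionOfSingularities.Theorems
open Summit.ResolutionOfSingularities.ResolutionOfSingularities.Cruxes.HypersurfaceCentreConstruction.LocalEngine

namespace Summit.ResolutionOfSingularities.ResolutionOfSingularities.Theorems.ELadderOne.Stage

variable {k : Type} [Field k] (S : Stage k) (ι : (R : Type) → [CommRing R] → R → Ordinal.{0})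

/-! ## Bookkeeping: dimension at the point of a minimal prime over `(U)`; homogeneous ideals inside the core -/

/-- The local ring at the point of a prime of an affine chart has dimension the height of the prime. [folklore] -/
theorem ringKrullDim_stalk_eq_height (W : S.Y.affineOpens) {z : S.Y} (hz : z ∈ (W : S.Y.Opens)) :
    ringKrullDim (S.Y.presheaf.stalk z) = ((W.2.primeIdealOf ⟨z, hz⟩).asIdeal.height : WithBot ℕ∞) := by
  rw [← ringKrullDim_eq_of_ringEquiv (stalkEquiv W hz)]
  exact IsLocalization.AtPrime.ringKrullDim_eq_height _ _

/-- **Krull at the point of a minimal prime over `N ≤ 3` sections**: `dim 𝒪_{Y,z} ≤ 3`. [folklore] -/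
theorem ringKrullDim_stalk_le_three_of_mem_minimalPrimes (W : S.Y.affineOpens) {N : ℕ} (hN : N ≤ 3) (U : Fin N → Γ(S.Y, W))
    {z : S.Y} (hz : z ∈ (W : S.Y.Opens))
    (hmin : (W.2.primeIdealOf ⟨z, hz⟩).asIdeal ∈ (Ideal.span (Set.range U)).minimalPrimes) :
    ringKrullDim (S.Y.presheaf.stalk z) ≤ ((3 : ℕ) : WithBot ℕ∞) := by
  classical
  haveI := S.isNoetherianRing_sections W
  rw [S.ringKrullDim_stalk_eq_height W hz]
  have hs : Set.range U = ((Finset.univ.image U : Finset Γ(S.Y, W)) : Set Γ(S.Y, W)) := by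
    rw [Finset.coe_image, Finset.coe_univ, Set.image_univ]
  rw [hs] at hmin
  have h1 := Ideal.height_le_card_of_mem_minimalPrimes_span_finset hmin
  have h2 : (Finset.univ.image U).card ≤ 3 :=
    Finset.card_image_le.trans (by rw [Finset.card_univ, Fintype.card_fin]; exact hN)
  have h3 : (W.2.primeIdealOf ⟨z, hz⟩).asIdeal.height ≤ (3 : ℕ∞) := h1.trans (by exact_mod_cast h2)
  have h4 : (((W.2.primeIdealOf ⟨z, hz⟩).asIdeal.height : ℕ∞) : WithBot ℕ∞) ≤ ((3 : ℕ∞) : WithBot ℕ∞) :=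
    WithBot.coe_le_coe.mpr h3
  exact h4.trans_eq (by norm_cast)

/-- A homogeneous ideal inside an ideal lies inside its homogeneous core. [folklore] -/
theorem le_toIdeal_homogeneousCore_of_isHomogeneous {ι' σ A : Type*} [CommRing A] [SetLike σ A] [AddSubmonoidClass σ A]
    (𝒜 : ι' → σ) [DecidableEq ι'] [AddMonoid ι'] [GradedRing 𝒜] {I P : Ideal A} (hI : I.IsHomogeneous 𝒜) (hIP : I ≤ P) :
    I ≤ (P.homogeneousCore 𝒜).toIdeal :=
  hI.toIdeal_homogeneousCore_eq_self.symm.trans_le (Ideal.homogeneousCore_mono 𝒜 hIP)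

/-! ## (M1): the common zeros of a model chart lie in the closure of the maximum locus -/

/-- **(M1) `V(U) ∩ D(t) ⊆ closure (maxLocus₂)`** (see the module docstring). [folklore] -/
theorem mem_closure_maxLocus₂_of_forall_germ_mem (h0 : S.InvDim₂) {a : S.atlas.ι} (ha : S.IsUnitChart a) {N : ℕ} (hN : N ≤ 3)
    (t : Γ(S.Y, S.atlas.W a)) (U : Fin N → Γ(S.Y, S.atlas.W a))
    (hUhom : letI := S.atlas.gradedRing a; ∀ i, SetLike.IsHomogeneousElem (S.atlas.piece a) (U i))
    (hS6 : ∀ (y : S.Y) (hy : y ∈ S.Y.basicOpen t), ringKrullDim (S.Y.presheaf.stalk y) ≤ ((3 : ℕ) : WithBot ℕ∞) →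
      ((∀ i, (S.Y.presheaf.germ (S.atlas.W a) y (S.Y.basicOpen_le t hy)).hom (U i) ∈ maximalIdeal (S.Y.presheaf.stalk y)) ↔
        (y ∈ singImage S.i.ker ∧ iotaAt ι S.i.ker y = S.mu₂ ι)))
    {y : S.Y} (hy : y ∈ S.Y.basicOpen t)
    (hUy : ∀ i, (S.Y.presheaf.germ (S.atlas.W a) y (S.Y.basicOpen_le t hy)).hom (U i) ∈ maximalIdeal (S.Y.presheaf.stalk y)) :
    y ∈ closure (S.maxLocus₂ ι) := by
  classical
  letI := S.atlas.gradedRing a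
  haveI := S.isNoetherianRing_sections (S.atlas.W a)
  haveI : JacobsonSpace S.Y := LocallyOfFiniteType.jacobsonSpace S.f
  have hya : y ∈ (S.atlas.W a : S.Y.Opens) := S.Y.basicOpen_le t hy
  set IU : Ideal Γ(S.Y, S.atlas.W a) := Ideal.span (Set.range U) with hIU
  have hIUhom : IU.IsHomogeneous (S.atlas.piece a) :=
    Ideal.homogeneous_span _ _ (by rintro _ ⟨i, rfl⟩; exact hUhom i)
  -- `(U) ≤ 𝔭(y)`, `t ∉ 𝔭(y)`
  have hIUy : IU ≤ ((S.atlas.W a).2.primeIdealOf ⟨y, hya⟩).asIdeal := by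
    rw [hIU, Ideal.span_le]
    rintro _ ⟨i, rfl⟩
    exact (germ_mem_maximalIdeal_iff_mem (S.atlas.W a) hya (U i)).mp (hUy i)
  have hty : t ∉ ((S.atlas.W a).2.primeIdealOf ⟨y, hya⟩).asIdeal := (mem_basicOpen_iff_not_mem (S.atlas.W a) hya t).mp hy
  -- a minimal prime `𝔷 ≤ 𝔭(y)` over `(U)` and its point `z`
  obtain ⟨𝔷, h𝔷min, h𝔷y⟩ := Ideal.exists_minimalPrimes_le hIUy
  have h𝔷p : 𝔷.IsPrime := h𝔷min.1.1
  obtain ⟨z, hza, hz𝔷⟩ := S.exists_primeIdealOf_eq a 𝔷 h𝔷p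
  subst hz𝔷
  have hzy : z ⤳ y := (S.specializes_iff_primeIdealOf_le a hya hza).mpr h𝔷y
  have hzt : z ∈ S.Y.basicOpen t :=
    (mem_basicOpen_iff_not_mem (S.atlas.W a) hza t).mpr fun h => hty (h𝔷y h)
  have h𝔷hom : ((S.atlas.W a).2.primeIdealOf ⟨z, hza⟩).asIdeal.IsHomogeneous (S.atlas.piece a) :=
    isHomogeneous_of_mem_minimalPrimes (S.atlas.piece a) hIUhom h𝔷min
  have hUz : ∀ i, U i ∈ ((S.atlas.W a).2.primeIdealOf ⟨z, hza⟩).asIdeal := fun i =>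
    h𝔷min.1.2 (Ideal.subset_span ⟨i, rfl⟩)
  -- (S6) at `z`: `z ∈ singImage`
  have hdimz : ringKrullDim (S.Y.presheaf.stalk z) ≤ ((3 : ℕ) : WithBot ℕ∞) :=
    S.ringKrullDim_stalk_le_three_of_mem_minimalPrimes (S.atlas.W a) hN U hza h𝔷min
  obtain ⟨hzsing, -⟩ := (hS6 z hzt hdimz).mp fun i => (germ_mem_maximalIdeal_iff_mem (S.atlas.W a) hza (U i)).mpr (hUz i)
  -- it suffices that `z ∈ closure (maxLocus₂)`
  suffices hzM : z ∈ closure (S.maxLocus₂ ι) from hzy.mem_closed isClosed_closure hzM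
  rw [mem_closure_iff]
  intro O hO hzO
  -- a closed point `c` of the locally closed set `O ∩ D(t) ∩ closure {z}`
  obtain ⟨c, ⟨⟨hcO, hct⟩, hcz⟩, hcc⟩ := nonempty_inter_closedPoints (X := S.Y) (Z := (O ∩ S.Y.basicOpen t) ∩ closure {z})
    ⟨z, ⟨hzO, hzt⟩, subset_closure rfl⟩ (((hO.inter (S.Y.basicOpen t).2).isLocallyClosed).inter isClosed_closure.isLocallyClosed)
  rw [mem_closedPoints_iff] at hcc
  have hzc : z ⤳ c := specializes_iff_mem_closure.mpr hcz
  have hca : c ∈ (S.atlas.W a : S.Y.Opens) := S.Y.basicOpen_le t hct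
  have hcsing : c ∈ singImage S.i.ker := hzc.mem_closed (isClosed_singImage S.f S.i.ker) hzsing
  obtain ⟨x, hx⟩ := mem_range_of_mem_singImage S hcsing
  subst hx
  -- the orbit-generic point `η(c)` over `c`
  obtain ⟨η, hηa, hcore, hηc, hog⟩ := S.exists_orbitGeneric_specializes ha hca hcc
  have hηsing : η ∈ singImage S.i.ker := S.mem_singImage_of_isOrbitGeneric_of_specializes hog hηc hcsing
  have hdimη : ringKrullDim (S.Y.presheaf.stalk η) ≤ ((3 : ℕ) : WithBot ℕ∞) :=
    S.ringKrullDim_stalk_le_three_of_isOrbitGeneric h0 hηsing hog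
  -- `η ∈ D(t)` and the `U i` vanish at `η` (`𝔷 ⊆ core 𝔭(c) = 𝔭(η)`, `𝔷` homogeneous)
  have h𝔷c : ((S.atlas.W a).2.primeIdealOf ⟨z, hza⟩).asIdeal ≤ ((S.atlas.W a).2.primeIdealOf ⟨S.i.base x, hca⟩).asIdeal :=
    (S.specializes_iff_primeIdealOf_le a hca hza).mp hzc
  have h𝔷η : ((S.atlas.W a).2.primeIdealOf ⟨z, hza⟩).asIdeal ≤ ((S.atlas.W a).2.primeIdealOf ⟨η, hηa⟩).asIdeal := by
    rw [hcore]
    exact le_toIdeal_homogeneousCore_of_isHomogeneous (S.atlas.piece a) h𝔷hom h𝔷c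
  have hηt : η ∈ S.Y.basicOpen t := by
    refine (mem_basicOpen_iff_not_mem (S.atlas.W a) hηa t).mpr fun h => ?_
    have hηle : ((S.atlas.W a).2.primeIdealOf ⟨η, hηa⟩).asIdeal ≤ ((S.atlas.W a).2.primeIdealOf ⟨S.i.base x, hca⟩).asIdeal :=
      (S.specializes_iff_primeIdealOf_le a hca hηa).mp hηc
    exact (mem_basicOpen_iff_not_mem (S.atlas.W a) hca t).mp hct (hηle h)
  have hUη : ∀ i, (S.Y.presheaf.germ (S.atlas.W a) η (S.Y.basicOpen_le t hηt)).hom (U i) ∈ maximalIdeal (S.Y.presheaf.stalk η) :=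
    fun i => (germ_mem_maximalIdeal_iff_mem (S.atlas.W a) (S.Y.basicOpen_le t hηt) (U i)).mpr (h𝔷η (hUz i))
  obtain ⟨-, hιη⟩ := (hS6 η hηt hdimη).mp hUη
  -- so `η ∈ maxLocus₂ ∩ O`
  exact ⟨η, hηc.mem_open hO hcO, ⟨hηsing, hog, hdimη⟩, hιη⟩


/-! ## `M ∩ D(t) ⊆ V(U)` -/

/-- **The parameters vanish on the closure of the maximum locus inside the chart**: by (S6) they vanish on `maxLocus₂ ∩ D(t)`, a dense subset
of `closure (maxLocus₂) ∩ D(t)`, and each `D(U i)` is open. [folklore] -/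
theorem forall_germ_mem_of_mem_closure_maxLocus₂ {a : S.atlas.ι} {N : ℕ} (t : Γ(S.Y, S.atlas.W a)) (U : Fin N → Γ(S.Y, S.atlas.W a))
    (hS6 : ∀ (y : S.Y) (hy : y ∈ S.Y.basicOpen t), ringKrullDim (S.Y.presheaf.stalk y) ≤ ((3 : ℕ) : WithBot ℕ∞) →
      ((∀ i, (S.Y.presheaf.germ (S.atlas.W a) y (S.Y.basicOpen_le t hy)).hom (U i) ∈ maximalIdeal (S.Y.presheaf.stalk y)) ↔
        (y ∈ singImage S.i.ker ∧ iotaAt ι S.i.ker y = S.mu₂ ι)))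
    {y : S.Y} (hy : y ∈ S.Y.basicOpen t) (hyM : y ∈ closure (S.maxLocus₂ ι)) (i : Fin N) :
    (S.Y.presheaf.germ (S.atlas.W a) y (S.Y.basicOpen_le t hy)).hom (U i) ∈ maximalIdeal (S.Y.presheaf.stalk y) := by
  have hya : y ∈ (S.atlas.W a : S.Y.Opens) := S.Y.basicOpen_le t hy
  by_contra hne
  have hyU : y ∈ S.Y.basicOpen (U i) :=
    (mem_basicOpen_iff_not_mem (S.atlas.W a) hya (U i)).mpr fun h =>
      hne ((germ_mem_maximalIdeal_iff_mem (S.atlas.W a) hya (U i)).mpr h)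
  obtain ⟨η, ⟨hηt, hηU⟩, hη⟩ := mem_closure_iff.mp hyM _ ((S.Y.basicOpen t).2.inter (S.Y.basicOpen (U i)).2) ⟨hy, hyU⟩
  have hηa : η ∈ (S.atlas.W a : S.Y.Opens) := S.Y.basicOpen_le t hηt
  have hUη := ((hS6 η hηt hη.1.2.2).mpr ⟨hη.1.1, hη.2⟩) i
  exact (mem_basicOpen_iff_not_mem (S.atlas.W a) hηa (U i)).mp hηU ((germ_mem_maximalIdeal_iff_mem (S.atlas.W a) hηa (U i)).mp hUη)

/-! ## (G-1): the cover of the closed points of `M` by model charts -/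

/-- **A homogeneous section off the core prime does not vanish at the point**: if `𝔭(η) = core 𝔭(c)` and `t ∉ 𝔭(η)` is HOMOGENEOUS, then
`c ∈ D(t)`. [folklore] -/
theorem mem_basicOpen_of_primeIdealOf_eq_homogeneousCore {a : S.atlas.ι} {c η : S.Y} (hca : c ∈ (S.atlas.W a : S.Y.Opens))
    (hηa : η ∈ (S.atlas.W a : S.Y.Opens))
    (hcore : letI := S.atlas.gradedRing a
      ((S.atlas.W a).2.primeIdealOf ⟨η, hηa⟩).asIdeal =
        ((((S.atlas.W a).2.primeIdealOf ⟨c, hca⟩).asIdeal).homogeneousCore (S.atlas.piece a)).toIdeal)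
    {δ : Fin S.j → ℤ} {t : Γ(S.Y, S.atlas.W a)} (ht : letI := S.atlas.gradedRing a; t ∈ S.atlas.piece a δ)
    (htη : t ∉ ((S.atlas.W a).2.primeIdealOf ⟨η, hηa⟩).asIdeal) : c ∈ S.Y.basicOpen t := by
  letI := S.atlas.gradedRing a
  refine (mem_basicOpen_iff_not_mem (S.atlas.W a) hca t).mpr fun htc => htη ?_
  rw [hcore]
  exact Ideal.mem_homogeneousCore_of_homogeneous_of_mem ⟨δ, ht⟩ htc

/-- **THE COVER (G-1)**: under (I0)₂ and (C-b), over a CLOSED point `c = i x` of `closure (maxLocus₂)` on a unit chart `W a` lies a point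
`η ∈ maxLocus₂ ∩ W a` with `𝔭(η) = core 𝔭(c)` (the orbit-generic point of …ELadderTwoOrbitClosurePoint: it is in `singImage` by the torus lemma,
has `dim ≤ 3` by U6, and lies in `closure (maxLocus₂)` because every basic open `D(f) ∋ η` has a homogeneous component `f_d ∉ 𝔭(c)`, whose
`D(f_d) ∋ c` meets `maxLocus₂` in a point with HOMOGENEOUS prime, hence inside `D(f)`). [folklore] -/
theorem exists_mem_maxLocus₂_primeIdealOf_eq_homogeneousCore (h0 : S.InvDim₂)
    (hcb : ∀ y ∈ S.genSing₂, y ∈ closure (S.maxLocus₂ ι) → y ∈ S.maxLocus₂ ι)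
    {a : S.atlas.ι} (ha : S.IsUnitChart a) {x : S.X} (hca : S.i.base x ∈ (S.atlas.W a : S.Y.Opens))
    (hcc : IsClosed ({S.i.base x} : Set S.Y)) (hcM : S.i.base x ∈ closure (S.maxLocus₂ ι)) :
    ∃ (η : S.Y) (hηa : η ∈ (S.atlas.W a : S.Y.Opens)), η ∈ S.maxLocus₂ ι ∧
      letI := S.atlas.gradedRing a
      ((S.atlas.W a).2.primeIdealOf ⟨η, hηa⟩).asIdeal =
        ((((S.atlas.W a).2.primeIdealOf ⟨S.i.base x, hca⟩).asIdeal).homogeneousCore (S.atlas.piece a)).toIdeal := by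
  classical
  letI := S.atlas.gradedRing a
  obtain ⟨η, hηa, hcore, hηc, hog⟩ := S.exists_orbitGeneric_specializes ha hca hcc
  have hcsing : S.i.base x ∈ singImage S.i.ker := S.closure_maxLocus₂_subset_singImage ι hcM
  have hηsing : η ∈ singImage S.i.ker := S.mem_singImage_of_isOrbitGeneric_of_specializes hog hηc hcsing
  have hdimη : ringKrullDim (S.Y.presheaf.stalk η) ≤ ((3 : ℕ) : WithBot ℕ∞) :=
    S.ringKrullDim_stalk_le_three_of_isOrbitGeneric h0 hηsing hog
  refine ⟨η, hηa, hcb η ⟨hηsing, hog, hdimη⟩ ?_, hcore⟩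
  -- `η ∈ closure (maxLocus₂)`
  have hPhom : ((((S.atlas.W a).2.primeIdealOf ⟨S.i.base x, hca⟩).asIdeal).homogeneousCore (S.atlas.piece a)).toIdeal.IsHomogeneous
      (S.atlas.piece a) := HomogeneousIdeal.isHomogeneous _
  rw [mem_closure_iff]
  intro O hO hηO
  obtain ⟨f, hfO, hηf⟩ := (S.atlas.W a).2.exists_basicOpen_le (V := ⟨O, hO⟩ ⊓ (S.atlas.W a : S.Y.Opens)) ⟨η, ⟨hηO, hηa⟩⟩ hηa
  have hfη : f ∉ ((S.atlas.W a).2.primeIdealOf ⟨η, hηa⟩).asIdeal := (mem_basicOpen_iff_not_mem (S.atlas.W a) hηa f).mp hηf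
  rw [hcore] at hfη
  obtain ⟨d, hd⟩ := E2Model.exists_decompose_not_mem (S.atlas.piece a) hPhom hfη
  have hdc : (DirectSum.decompose (S.atlas.piece a) f d : Γ(S.Y, S.atlas.W a)) ∉
      ((S.atlas.W a).2.primeIdealOf ⟨S.i.base x, hca⟩).asIdeal := fun h =>
    hd (Ideal.mem_homogeneousCore_of_homogeneous_of_mem ⟨d, SetLike.coe_mem _⟩ h)
  have hcfd : S.i.base x ∈ S.Y.basicOpen (DirectSum.decompose (S.atlas.piece a) f d : Γ(S.Y, S.atlas.W a)) :=
    (mem_basicOpen_iff_not_mem (S.atlas.W a) hca _).mpr hdc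
  obtain ⟨η', hη'fd, hη'⟩ := mem_closure_iff.mp hcM _ (S.Y.basicOpen _).2 hcfd
  have hη'a : η' ∈ (S.atlas.W a : S.Y.Opens) := S.Y.basicOpen_le _ hη'fd
  have hη'hom := (hη'.1.2.1 a ha hη'a).1
  have hfdη' : (DirectSum.decompose (S.atlas.piece a) f d : Γ(S.Y, S.atlas.W a)) ∉
      ((S.atlas.W a).2.primeIdealOf ⟨η', hη'a⟩).asIdeal := (mem_basicOpen_iff_not_mem (S.atlas.W a) hη'a _).mp hη'fd
  have hfη' : f ∉ ((S.atlas.W a).2.primeIdealOf ⟨η', hη'a⟩).asIdeal := fun h => hfdη' (hη'hom d h)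
  have hη'f : η' ∈ S.Y.basicOpen f := (mem_basicOpen_iff_not_mem (S.atlas.W a) hη'a f).mpr hfη'
  exact ⟨η', (hfO hη'f).1, hη'⟩

end Summit.ResolutionOfSingularities.ResolutionOfSingularities.Theorems.ELadderOne.Stage

end
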